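import Literature.NumberTheory.CubicFields.UniformitySubringStep
import Mathlib.Analysis.PSeries
import Mathlib.Analysis.SpecialFunctions.Exp
import Mathlib.Data.Nat.Factorization.Basic
import HarnessLib

/-!
# A uniform bound for the number of subrings of index `n` of a maximal cubic ring, summable against `n⁻²`

`Proofs`-style file (theorems only: no definitions, no named facts). Topic
`Literature/NumberTheory/CubicFields`; continues `UniformitySubringStep.lean` (the recursion
`A(n) ≤ 3A(n/p) + (p+1)A(n/p³)` for the orbits of index `n` in a maximal `R(g)` primitive at `p`, and
`a(n) ≤ A(n) + a(n/p²)`).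

In the published proof of Belabas–Bhargava–Pomerance 2010, Lemma 3.4 (= Bhargava–Taniguchi–Thorne 2023,
Prop. 4.5), as recalled by Taniguchi–Thorne 2013 (proof of Lemma 14), the subrings of index `n` of a fixed
maximal cubic ring are controlled by the Datskovsky–Wright bound `η_R(s) ≼ ζ(2s)ζ(3s−1)ζ(s)³`, whose only
use is that `Σ_n (#subrings of index n)·n⁻²` is bounded by an absolute constant with an Euler-product
structure. This file proves exactly that much from the recursion, with explicit (crude) constants:

* `ncard_primOrbits_pow_mul_le`, `ncard_indexPOrbits_pow_mul_le` — for `p ∤ m`: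
  `A(pⁱm) ≤ Ā(i)·a(m)` and `a(pⁱm) ≤ ē(i)·a(m)` for ANY sequences with `Ā(0,1,2) = (1,3,9)`,
  `Ā(i+3) = 3Ā(i+2) + (p+1)Ā(i)`, `ē(0,1) = (1,3)`, `ē(i+2) = Ā(i+2) + ē(i)` (hypothesised, so that no
  definition is needed; they exist, `exists_recursion_seqs`);
* `ncard_indexPOrbits_le_factorization_prod` — **`a(n) ≤ e(n) := ∏_{pⁱ ∥ n} ē_p(i)`** uniformly in the
  maximal ring;
* `sum_range_abar_le`, `sum_range_ebar_le` — for `x ≥ 0` with `θ = 3x + (p+1)x³ < 1`: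
  `Σ_{i<I} Ā(i) xⁱ ≤ (1 − θ)⁻¹` and `Σ_{i<I} ē(i) xⁱ ≤ ((1 − x²)(1 − θ))⁻¹` (used at `x = p⁻²`).

The numerics at `x = p⁻²` (`E_p ≤ 1 + 19/p²`), the Euler product `Σ_{n ≤ N} e(n)/n² ≤ ∏_p E_p ≤ e¹⁹` and
the packaged statement are in `UniformitySubringEuler.lean`.

## References

* K. Belabas, M. Bhargava, C. Pomerance, *Error estimates for the Davenport–Heilbronn theorems*,
  Duke Math. J. 153 (2010) 173–210, Lemma 2.4, Remark 2.5, Lemma 3.4 [BelabasBhargavaPomerance2010].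
* T. Taniguchi, F. Thorne, *Secondary terms in counting functions for cubic fields*, Duke Math. J.
  162 (2013), proof of Lemma 14 [TaniguchiThorne2013].
* M. Bhargava, T. Taniguchi, F. Thorne, *Improved error estimates for the Davenport–Heilbronn
  theorems*, Math. Ann. 389 (2024) = arXiv:2107.12819, Lemma 2.3, Prop. 4.5 [BhargavaTaniguchiThorne2023].
-/

noncomputable section

namespace Literature.NumberTheory.CubicFields

open BinaryCubic RingOfForm Finset

/-! ### The recursion solved against hypothesised sequences -/

section PerPrime

variable {g : BinaryCubic ℤ} (hg : IsMaximal g) (hg0 : g.disc ≠ 0) (p : ℕ) [hp : Fact p.Prime]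
variable (A : ℕ → ℕ) (hA0 : A 0 = 1) (hA1 : A 1 = 3) (hA2 : A 2 = 9)
  (hA : ∀ i, A (i + 3) = 3 * A (i + 2) + (p + 1) * A i)
include hg hg0

omit hg hg0 in
/-- `p ∤ m ⇒ pᵏ⁺¹ ∤ pᵏ m`. [folklore] -/
theorem not_pow_succ_dvd_pow_mul {m : ℕ} (hm : ¬ p ∣ m) (k : ℕ) : ¬ p ^ (k + 1) ∣ p ^ k * m := by
  intro h
  rw [pow_succ] at h
  exact hm (Nat.dvd_of_mul_dvd_mul_left (pow_pos hp.out.pos k) h)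

include hA0 hA1 hA2 hA in
/-- **`A(pⁱ m) ≤ Ā(i) · a(m)`** for `p ∤ m`: the orbits of index `pⁱm` in the maximal `R(g)` primitive at `p`,
against any solution `Ā` of `Ā(0,1,2) = (1,3,9)`, `Ā(i+3) = 3Ā(i+2) + (p+1)Ā(i)`. [folklore] -/
theorem ncard_primOrbits_pow_mul_le {m : ℕ} (hm : ¬ p ∣ m) (i : ℕ) :
    {O ∈ indexPOrbits g (p ^ i * m) | ¬ (repOf O).IsMultiple p}.ncard ≤ A i * (indexPOrbits g m).ncard := by
  induction i using Nat.strong_induction_on with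
  | _ i ih =>
    have hfin : ∀ k, {O ∈ indexPOrbits g k | ¬ (repOf O).IsMultiple p}.ncard ≤ (indexPOrbits g k).ncard :=
      fun k => Set.ncard_le_ncard (Set.sep_subset _ _) (indexPOrbits_finite' hg0 k)
    have hdiv1 : ∀ k, p ^ (k + 1) * m / p = p ^ k * m := fun k => by
      rw [pow_succ, mul_comm (p ^ k) p, mul_assoc, Nat.mul_div_cancel_left _ hp.out.pos]
    have hdiv3 : ∀ k, p ^ (k + 3) * m / p ^ 3 = p ^ k * m := fun k => by
      rw [pow_add, mul_comm (p ^ k) (p ^ 3), mul_assoc, Nat.mul_div_cancel_left _ (pow_pos hp.out.pos 3)]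
    have hdvd : ∀ k, p ∣ p ^ (k + 1) * m := fun k => ⟨p ^ k * m, by ring⟩
    rcases i with _ | _ | _ | i
    · simpa [hA0] using hfin m
    · -- `A(pm) ≤ 3 A(m) ≤ 3 a(m)`
      have h3 : ¬ p ^ 3 ∣ p ^ 1 * m := fun h =>
        not_pow_succ_dvd_pow_mul p hm 1 ((pow_dvd_pow p (by norm_num : 2 ≤ 3)).trans h)
      refine (ncard_primOrbits_le_of_not_dvd p hg hg0 (hdvd 0) h3).trans ?_
      rw [hdiv1 0, hA1, pow_zero, one_mul]
      exact Nat.mul_le_mul_left 3 (hfin m)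
    · have h3 : ¬ p ^ 3 ∣ p ^ 2 * m := not_pow_succ_dvd_pow_mul p hm 2
      refine (ncard_primOrbits_le_of_not_dvd p hg hg0 (hdvd 1) h3).trans ?_
      rw [hdiv1 1, hA2]
      have := ih 1 (by norm_num)
      rw [hA1] at this
      linarith
    · refine (ncard_primOrbits_le p hg hg0 (hdvd (i + 2))).trans ?_
      rw [show i + 2 + 1 = i + 3 from rfl, hdiv1 (i + 2), hdiv3 i, hA i]
      have h2 := ih (i + 2) (by omega)
      have h0 := ih i (by omega)
      nlinarith

variable (E : ℕ → ℕ) (hE0 : E 0 = 1) (hE1 : E 1 = 3) (hE : ∀ i, E (i + 2) = A (i + 2) + E i)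

include hA0 hA1 hA2 hA hE0 hE1 hE in
/-- **`a(pⁱ m) ≤ ē(i) · a(m)`** for `p ∤ m`, with `ē(0,1) = (1,3)`, `ē(i+2) = Ā(i+2) + ē(i)` (the orbits
imprimitive at `p` come from index `pⁱ⁻²m`). [folklore] -/
theorem ncard_indexPOrbits_pow_mul_le {m : ℕ} (hm : ¬ p ∣ m) (i : ℕ) :
    (indexPOrbits g (p ^ i * m)).ncard ≤ E i * (indexPOrbits g m).ncard := by
  induction i using Nat.strong_induction_on with
  | _ i ih =>
    have hprim := ncard_primOrbits_pow_mul_le hg hg0 p A hA0 hA1 hA2 hA hm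
    rcases i with _ | _ | i
    · have h2 : ¬ p ^ 2 ∣ p ^ 0 * m := fun h => hm ((dvd_pow_self p two_ne_zero).trans (by simpa using h))
      exact (ncard_indexPOrbits_le_prim p hg hg0 h2).trans (by simpa [hE0, hA0] using hprim 0)
    · refine (ncard_indexPOrbits_le_prim p hg hg0 (not_pow_succ_dvd_pow_mul p hm 1)).trans ?_
      simpa [hE1, hA1] using hprim 1
    · refine (ncard_indexPOrbits_le_prim_add p hg hg0).trans ?_
      have hdiv2 : p ^ (i + 2) * m / p ^ 2 = p ^ i * m := by
        rw [pow_add, mul_comm (p ^ i) (p ^ 2), mul_assoc, Nat.mul_div_cancel_left _ (pow_pos hp.out.pos 2)]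
      rw [hdiv2, hE i, add_mul]
      exact Nat.add_le_add (hprim (i + 2)) (ih i (by omega))

end PerPrime

/-! ### All primes: the multiplicative bound `e(n) = ∏_{pⁱ ∥ n} ē_p(i)` -/

section AllPrimes

variable (A E : ℕ → ℕ → ℕ) (hA0 : ∀ p, A p 0 = 1) (hA1 : ∀ p, A p 1 = 3) (hA2 : ∀ p, A p 2 = 9)
  (hA : ∀ p i, A p (i + 3) = 3 * A p (i + 2) + (p + 1) * A p i)
  (hE0 : ∀ p, E p 0 = 1) (hE1 : ∀ p, E p 1 = 3) (hE : ∀ p i, E p (i + 2) = A p (i + 2) + E p i)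

include hE0 in
/-- **Multiplicativity of `e`**: `e(pⁱ m) = ē_p(i) · e(m)` for `p` prime, `p ∤ m`, `m ≠ 0`. [folklore] -/
theorem factorization_prod_pow_mul {p m : ℕ} (hp : p.Prime) (hm : ¬ p ∣ m) (hm0 : m ≠ 0) (i : ℕ) :
    (p ^ i * m).factorization.prod (fun q j => E q j) = E p i * m.factorization.prod (fun q j => E q j) := by
  rcases Nat.eq_zero_or_pos i with rfl | hi
  · rw [pow_zero, one_mul, hE0, one_mul]
  rw [Nat.factorization_mul (pow_ne_zero i hp.ne_zero) hm0, hp.factorization_pow,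
    Finsupp.prod_add_index_of_disjoint, Finsupp.prod_single_index (hE0 p)]
  rw [Finsupp.support_single _ hi.ne', Nat.support_factorization, Finset.disjoint_singleton_left]
  exact fun h => hm (Nat.dvd_of_mem_primeFactors h)

include hA0 hA1 hA2 hA hE0 hE1 hE in
/-- **The uniform bound `a_g(n) ≤ e(n)`** for every maximal nondegenerate `g` and `n ≥ 1`. [folklore] -/
theorem ncard_indexPOrbits_le_factorization_prod {g : BinaryCubic ℤ} (hg : IsMaximal g) (hg0 : g.disc ≠ 0)
    {n : ℕ} (hn : 0 < n) : (indexPOrbits g n).ncard ≤ n.factorization.prod (fun q j => E q j) := by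
  induction n using Nat.strong_induction_on with
  | _ n ih =>
    rcases Nat.lt_or_ge 1 n with h1 | h1
    · -- `n = pⁱ m`, `p = minFac n`, `m = ordCompl`
      set p := n.minFac with hpdef
      have hpp : p.Prime := Nat.minFac_prime h1.ne'
      haveI : Fact p.Prime := ⟨hpp⟩
      set i := n.factorization p
      set m := n / p ^ i with hmdef
      have hnm : p ^ i * m = n := Nat.ordProj_mul_ordCompl_eq_self n p
      have hm : ¬ p ∣ m := Nat.not_dvd_ordCompl hpp hn.ne'
      have hm0 : 0 < m := Nat.ordCompl_pos p hn.ne'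
      have hi : 0 < i := hpp.factorization_pos_of_dvd hn.ne' (Nat.minFac_dvd n)
      have hmn : m < n := by
        rw [← hnm]
        refine lt_mul_of_one_lt_left hm0 (Nat.one_lt_pow hi.ne' hpp.one_lt)
      calc (indexPOrbits g n).ncard = (indexPOrbits g (p ^ i * m)).ncard := by rw [hnm]
        _ ≤ E p i * (indexPOrbits g m).ncard :=
            ncard_indexPOrbits_pow_mul_le hg hg0 p (A p) (hA0 p) (hA1 p) (hA2 p) (hA p) (E p) (hE0 p) (hE1 p)
              (hE p) hm i
        _ ≤ E p i * m.factorization.prod (fun q j => E q j) := Nat.mul_le_mul_left _ (ih m hmn hm0)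
        _ = n.factorization.prod (fun q j => E q j) := by
            rw [← factorization_prod_pow_mul E hE0 hpp hm hm0.ne', hnm]
    · obtain rfl : n = 1 := le_antisymm h1 hn
      simpa using ncard_indexPOrbits_one_le g

end AllPrimes

/-! ### Partial sums of the recursion against `p^{-2i}` -/

section Sums

variable (p : ℕ) (A : ℕ → ℕ) (hA0 : A 0 = 1) (hA1 : A 1 = 3) (hA2 : A 2 = 9)
  (hA : ∀ i, A (i + 3) = 3 * A (i + 2) + (p + 1) * A i)

include hA0 hA1 hA2 hA in
/-- The identity `s_{I+3} = 1 + 3x·s_{I+2} + (p+1)x³·s_I` for the partial sums `s_K = Σ_{i<K} Ā(i)xⁱ`. [folklore] -/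
theorem sum_range_abar_succ (x : ℝ) (I : ℕ) :
    ∑ i ∈ range (I + 3), (A i : ℝ) * x ^ i =
      1 + 3 * x * ∑ i ∈ range (I + 2), (A i : ℝ) * x ^ i + (p + 1) * x ^ 3 * ∑ i ∈ range I, (A i : ℝ) * x ^ i := by
  induction I with
  | zero =>
    simp only [Finset.sum_range_succ, Finset.sum_range_zero, hA0, hA1, hA2]
    push_cast; ring
  | succ I ih =>
    rw [Finset.sum_range_succ (fun i => (A i : ℝ) * x ^ i) (I + 3)]
    nth_rw 1 [ih]
    rw [Finset.sum_range_succ (fun i => (A i : ℝ) * x ^ i) (I + 2),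
      Finset.sum_range_succ (fun i => (A i : ℝ) * x ^ i) I, hA I]
    push_cast; ring

include hA0 hA1 hA2 hA in
/-- **`Σ_{i<I} Ā(i)xⁱ ≤ (1 − θ)⁻¹`** for `θ = 3x + (p+1)x³ < 1`, `x ≥ 0` (from the identity and monotonicity
of the partial sums). [folklore] -/
theorem sum_range_abar_le {x : ℝ} (hx : 0 ≤ x) (hθ : 3 * x + (p + 1) * x ^ 3 < 1) (I : ℕ) :
    ∑ i ∈ range I, (A i : ℝ) * x ^ i ≤ (1 - (3 * x + (p + 1) * x ^ 3))⁻¹ := by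
  have hmono : Monotone fun K => ∑ i ∈ range K, (A i : ℝ) * x ^ i :=
    fun K L hKL => Finset.sum_le_sum_of_subset_of_nonneg (Finset.range_mono hKL) fun i _ _ => by positivity
  have hI3 := sum_range_abar_succ p A hA0 hA1 hA2 hA x I
  set s3 := ∑ i ∈ range (I + 3), (A i : ℝ) * x ^ i with hs3def
  have h2 : ∑ i ∈ range (I + 2), (A i : ℝ) * x ^ i ≤ s3 := hmono (by omega)
  have h0 : ∑ i ∈ range I, (A i : ℝ) * x ^ i ≤ s3 := hmono (by omega)
  have hs3 : s3 ≤ 1 + (3 * x + (p + 1) * x ^ 3) * s3 := by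
    have e2 := mul_le_mul_of_nonneg_left h2 (by positivity : (0 : ℝ) ≤ 3 * x)
    have e0 := mul_le_mul_of_nonneg_left h0 (by positivity : (0 : ℝ) ≤ (p + 1) * x ^ 3)
    linarith
  have hθ0 : 0 < 1 - (3 * x + (p + 1) * x ^ 3) := by linarith
  refine h0.trans ?_
  rw [inv_eq_one_div, le_div_iff₀ hθ0]
  nlinarith

variable (E : ℕ → ℕ) (hE0 : E 0 = 1) (hE1 : E 1 = 3) (hE : ∀ i, E (i + 2) = A (i + 2) + E i)

include hA0 hA1 hE0 hE1 hE in
/-- The identity `t_{I+2} = s_{I+2} + x²·t_I` for `t_K = Σ_{i<K} ē(i)xⁱ`. [folklore] -/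
theorem sum_range_ebar_succ (x : ℝ) (I : ℕ) :
    ∑ i ∈ range (I + 2), (E i : ℝ) * x ^ i =
      ∑ i ∈ range (I + 2), (A i : ℝ) * x ^ i + x ^ 2 * ∑ i ∈ range I, (E i : ℝ) * x ^ i := by
  induction I with
  | zero =>
    simp only [Finset.sum_range_succ, Finset.sum_range_zero, hA0, hA1, hE0, hE1]
    push_cast; ring
  | succ I ih =>
    rw [Finset.sum_range_succ (fun i => (E i : ℝ) * x ^ i) (I + 2)]
    nth_rw 1 [ih]
    rw [Finset.sum_range_succ (fun i => (A i : ℝ) * x ^ i) (I + 2),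
      Finset.sum_range_succ (fun i => (E i : ℝ) * x ^ i) I, hE I]
    push_cast; ring

include hA0 hA1 hA2 hA hE0 hE1 hE in
/-- **`Σ_{i<I} ē(i)xⁱ ≤ ((1 − x²)(1 − θ))⁻¹`** for `θ < 1`, `0 ≤ x < 1`. [folklore] -/
theorem sum_range_ebar_le {x : ℝ} (hx : 0 ≤ x) (hx1 : x ^ 2 < 1) (hθ : 3 * x + (p + 1) * x ^ 3 < 1) (I : ℕ) :
    ∑ i ∈ range I, (E i : ℝ) * x ^ i ≤ ((1 - x ^ 2) * (1 - (3 * x + (p + 1) * x ^ 3)))⁻¹ := by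
  have hmono : Monotone fun K => ∑ i ∈ range K, (E i : ℝ) * x ^ i :=
    fun K L hKL => Finset.sum_le_sum_of_subset_of_nonneg (Finset.range_mono hKL) fun i _ _ => by positivity
  have hI2 := sum_range_ebar_succ A hA0 hA1 E hE0 hE1 hE x I
  have hs := sum_range_abar_le p A hA0 hA1 hA2 hA hx hθ (I + 2)
  set t2 := ∑ i ∈ range (I + 2), (E i : ℝ) * x ^ i
  have h0 : ∑ i ∈ range I, (E i : ℝ) * x ^ i ≤ t2 := hmono (by omega)
  have hθ0 : 0 < 1 - (3 * x + (p + 1) * x ^ 3) := by linarith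
  have hx0 : 0 < 1 - x ^ 2 := by linarith
  have ht2 : t2 * (1 - x ^ 2) ≤ (1 - (3 * x + (p + 1) * x ^ 3))⁻¹ := by
    have e0 := mul_le_mul_of_nonneg_left h0 (by positivity : (0 : ℝ) ≤ x ^ 2)
    nlinarith
  refine h0.trans ?_
  rw [mul_comm (1 - x ^ 2), mul_inv, ← div_eq_mul_inv, le_div_iff₀ hx0]
  exact ht2

end Sums

end Literature.NumberTheory.CubicFields

end
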